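import Literature.Combinatorics.Additive.DeZeeuwLineIntersectionBound
import Literature.Combinatorics.Extremal.LinesThroughPointOfSurface
import Literature.Combinatorics.Extremal.LinesOnPlaneCurve
import HarnessLib

/-!
# Line–line intersections on one irreducible surface, from Kollár's three classical theorems

Topic `Literature/Combinatorics/Extremal` (lines on algebraic surfaces; incidence geometry over
arbitrary fields). Everything in this file is PROVED; the three deep inputs are explicit
hypotheses, stated inline, each the affine rendering of ONE printed theorem of

* [Kollar2015] J. Kollár, *Szemerédi–Trotter-type theorems in dimension 3*, Adv. Math. 271 (2015)
  30–61 (arXiv:1405.2243).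

The target is the "single-component bound" `GKK` — the one remaining hypothesis of
`Literature.Combinatorics.Additive.stevensDeZeeuw_thm4_of_componentBound_closed`
(`DeZeeuwLineIntersectionBound.lean`), i.e. the only input separating the named fact
`Literature.Combinatorics.Additive.stevensDeZeeuw_thm4` (Stevens–de Zeeuw 2017, Theorem 4) from a
proof: *for `K` algebraically closed, `f ∈ K[X₀,X₁,X₂]` irreducible of degree `d ≥ 3` with
`char K = 0` or `d < char K`, two disjoint finite families `L, M` of lines on `{f = 0}` and a
finite set `I` of points each on a line of `L` and a line of `M`, `|I| ≤ C_K (d³ + d|L| + |M|)`.*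
This is how de Zeeuw (arXiv:1612.02719, proof of Lemma 3.1) uses Kollár's paper, component by
component. Kollár's own route to it ([Kollar2015, §2 (17)–(24)]) is a case distinction —
cones, other ruled surfaces, non-ruled surfaces — resting on three theorems that we take as the
hypotheses `H13`, `H14`, `H55` of `componentBound_closed_of_kollar`:

* `H13` = **Theorem 13 (Monge–Salmon–Cayley)** [Kollar2015, Thm. 13; in characteristic `p` for
  degree `< p`: ¶38–39 and Cor. 40, after Voloch 2003]: if the irreducible surface `S = {f = 0}`
  is not ruled, there is a surface `T = {g = 0}` of degree `11d - 24 ≤ 11d` without common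
  component with `S` (`f ∤ g`) containing every line of `S`. (Affine rendering: "ruled" is taken
  in the weakest sense used — every point of `S` lies on a line of `S` — so that "not ruled" here
  implies "no ruled component" there; for an arbitrary algebraically closed field of
  characteristic `0` the statement over `ℂ` transfers by the Lefschetz principle, the assertion
  being first-order for each fixed `d`.)
* `H14` = **Proposition 14 (2)** [Kollar2015, Prop. 14 (2), proved in §§5–6 via the arithmetic
  genus of subcurves of complete intersections]: for surfaces `S, T` of degrees `a, b` without
  common component and `C = S ∩ T`, `∑_{p ∈ C} (r(p) - 1) ≤ ½ab(a+b-2)`, `r(p)` the multiplicity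
  of `C` at `p`; for a finite family `Λ` of lines on `S ∩ T` and points `p` on them,
  `r(p) ≥ #{ℓ ∈ Λ : p ∈ ℓ}`, which gives the rendering below (a sub-sum of Kollár's).
* `H55` = **Proposition 55 (4), (5)** with ¶54 [Kollar2015, §7]: on a non-special ruled surface
  (irreducible, not a plane, a smooth quadric or a cone — affinely: degree `≥ 3`, not a cone, not
  a cylinder, i.e. not a cone with vertex at infinity) there are at most `2` special lines, every
  other line is a ruling, and a ruling meets at most `d - 2` other non-special lines; hence a
  non-special line carries at most `d - 2` points lying on other non-special lines.

What is PROVED here (the glue of [Kollar2015, §2 (20) and Cor. 21], plus the two degenerate ruled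
cases which Prop. 55 excludes):
* `direction_eq_span_of_line_on_cylinder`, `card_eq_zero_of_cylinder` — on an irreducible
  cylinder of degree `≥ 2` every line is parallel to the axis, so two disjoint line families have
  NO common point (the "cone with vertex at infinity" case of ¶54);
* the affine-cone case is `card_le_one_of_cone` (`LinesThroughPointOfSurface.lean`);
* `componentBound_closed_of_kollar` — `H13 → H14 → H55 → GKK` with `C_K = 66`
  (ruled: `|I| ≤ d|L| + 2|M|`; non-ruled: `|I| ≤ ½·d·11d·(12d-2) ≤ 66d³`, [Kollar2015, Cor. 21]);
* `stevensDeZeeuw_thm4_of_kollar` — the chain down to the named fact.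

Deliberately NOT here: proofs of `H13` (flecnodes, Monge–Salmon–Cayley), `H14` (Hilbert
polynomials / arithmetic genus of complete-intersection curves) and `H55` (smooth models of ruled
surfaces and intersection numbers) — three independent classical theorems, none of which is in
Mathlib.

## References
* [Kollar2015] J. Kollár, Adv. Math. 271 (2015) — Thm. 13, Prop. 14, §2 (17)–(24), Cor. 21,
  ¶38–40, §7 ¶54, Prop. 55.
* [deZeeuw2016] F. de Zeeuw, arXiv:1612.02719 — proof of Lemma 3.1 (how the three results are used).
* [StevensDeZeeuw2017] S. Stevens, F. de Zeeuw, Bull. LMS 49 (2017) — Theorem 4.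
-/

namespace Literature.Combinatorics.Extremal

open MvPolynomial Finset
open Literature.Combinatorics.Additive.DeZeeuw (eq_of_mem_of_mem)

/-! ### Cylinders: every line is parallel to the axis -/

section Cylinder

variable {K : Type*} [Field K]

/-- **Lines on an irreducible cylinder are parallel to its axis.** If `f` is irreducible of
degree `≥ 2` over an infinite field and translation-invariant in the direction `v ≠ 0`
(`f(p + t v) = f(p)`), then every line on `{f = 0}` has direction `K ∙ v`: otherwise the plane
spanned by the line and `v` would lie on the surface, contradicting
`exists_mem_eval_ne_zero_of_irreducible`. (The affine form of "on a cone, every line passes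
through the vertex" for a vertex at infinity, [Kollar2015, §7 ¶54].) [folklore] -/
theorem direction_eq_span_of_line_on_cylinder [Infinite K] {f : MvPolynomial (Fin 3) K}
    (hf : Irreducible f) (hd : 2 ≤ f.totalDegree) {v : Fin 3 → K} (hv : v ≠ 0)
    (hcyl : ∀ (p : Fin 3 → K) (t : K), eval (p + t • v) f = eval p f)
    (ℓ : AffineSubspace K (Fin 3 → K)) (hℓ : Module.finrank K ℓ.direction = 1)
    (hℓf : ∀ z ∈ ℓ, eval z f = 0) : ℓ.direction = K ∙ v := by
  obtain ⟨uw, hw, hmem, hdir⟩ := exists_point_dir_of_finrank_eq_one ℓ hℓ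
  -- the direction `w` of `ℓ` and the axis `v` are linearly dependent
  have hdep : ¬ LinearIndependent K ![uw.2, v] := by
    intro hind
    -- the plane `u + span(w, v)` lies on the surface
    set Pl : AffineSubspace K (Fin 3 → K) :=
      AffineSubspace.mk' uw.1 (Submodule.span K (Set.range ![uw.2, v])) with hPl_def
    have hPl : Module.finrank K Pl.direction = 2 := by
      rw [hPl_def, AffineSubspace.direction_mk', finrank_span_eq_card hind]
      simp
    obtain ⟨z, hz, hzf⟩ := exists_mem_eval_ne_zero_of_irreducible hf hd Pl hPl
    apply hzf
    rw [hPl_def, AffineSubspace.mem_mk', Submodule.mem_span_range_iff_exists_fun] at hz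
    obtain ⟨c, hc⟩ := hz
    have hz_eq : z = (uw.1 + c 0 • uw.2) + c 1 • v := by
      have : z -ᵥ uw.1 = c 0 • uw.2 + c 1 • v := by
        rw [← hc]; simp [Fin.sum_univ_two]
      rw [vsub_eq_sub] at this
      calc z = uw.1 + (z - uw.1) := by abel
        _ = _ := by rw [this]; abel
    rw [hz_eq, hcyl]
    exact hℓf _ ((hmem _).2 ⟨c 0, rfl⟩)
  rw [LinearIndependent.pair_iff] at hdep
  push Not at hdep
  obtain ⟨a, b, hab, hne⟩ := hdep
  have ha : a ≠ 0 := by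
    intro ha0
    rw [ha0, zero_smul, zero_add, smul_eq_zero] at hab
    rcases hab with hb | hv0
    · exact hne ha0 hb
    · exact hv hv0
  have hb : b ≠ 0 := by
    intro hb0
    rw [hb0, zero_smul, add_zero, smul_eq_zero] at hab
    rcases hab with ha0 | hw0
    · exact ha ha0
    · exact hw hw0
  -- `w = -(b/a) • v`, so the spans agree
  have hwv : uw.2 = (-(b / a)) • v := by
    have h1 : a • uw.2 = -(b • v) := eq_neg_of_add_eq_zero_left hab
    calc uw.2 = a⁻¹ • (a • uw.2) := by rw [smul_smul, inv_mul_cancel₀ ha, one_smul]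
      _ = -(b / a) • v := by rw [h1, smul_neg, smul_smul, ← neg_smul, div_eq_inv_mul]
  rw [hdir, hwv]
  refine le_antisymm ?_ ?_
  · rw [Submodule.span_singleton_le_iff_mem]
    exact Submodule.smul_mem _ _ (Submodule.mem_span_singleton_self v)
  · rw [Submodule.span_singleton_le_iff_mem, Submodule.mem_span_singleton]
    refine ⟨(-(b / a))⁻¹, ?_⟩
    rw [smul_smul, inv_mul_cancel₀ (neg_ne_zero.2 (div_ne_zero hb ha)), one_smul]

/-- **The cylinder case of the Guth–Katz–Kollár component bound**: on an irreducible cylinder of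
degree `≥ 2` over an infinite field, two disjoint finite families `L, M` of lines have NO point
lying on a line of each family — all lines are parallel to the axis
(`direction_eq_span_of_line_on_cylinder`), and two distinct parallel lines are disjoint.
(Cones with vertex at infinity, [Kollar2015, §7 ¶54].) [folklore] -/
theorem card_eq_zero_of_cylinder [Infinite K] {f : MvPolynomial (Fin 3) K} (hf : Irreducible f)
    (hd : 2 ≤ f.totalDegree) {v : Fin 3 → K} (hv : v ≠ 0)
    (hcyl : ∀ (p : Fin 3 → K) (t : K), eval (p + t • v) f = eval p f)
    (L M : Finset (AffineSubspace K (Fin 3 → K)))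
    (hL : ∀ ℓ ∈ L, Module.finrank K ℓ.direction = 1)
    (hM : ∀ m ∈ M, Module.finrank K m.direction = 1) (hLM : Disjoint L M)
    (hLf : ∀ ℓ ∈ L, ∀ z ∈ ℓ, eval z f = 0) (hMf : ∀ m ∈ M, ∀ z ∈ m, eval z f = 0)
    (I : Finset (Fin 3 → K)) (hI : ∀ z ∈ I, (∃ ℓ ∈ L, z ∈ ℓ) ∧ (∃ m ∈ M, z ∈ m)) :
    I.card = 0 := by
  rw [Finset.card_eq_zero, Finset.eq_empty_iff_forall_notMem]
  intro z hz
  obtain ⟨⟨ℓ, hℓ, hzℓ⟩, ⟨m, hm, hzm⟩⟩ := hI z hz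
  have hne : ℓ ≠ m := fun h => Finset.disjoint_left.1 hLM hℓ (h ▸ hm)
  refine hne (AffineSubspace.ext_of_direction_eq ?_ ⟨z, hzℓ, hzm⟩)
  rw [direction_eq_span_of_line_on_cylinder hf hd hv hcyl ℓ (hL ℓ hℓ) (hLf ℓ hℓ),
    direction_eq_span_of_line_on_cylinder hf hd hv hcyl m (hM m hm) (hMf m hm)]

end Cylinder

/-! ### The component bound from Kollár's Theorem 13, Proposition 14 (2) and Proposition 55 -/

section ComponentBound

open scoped Classical

/-- **The Guth–Katz–Kollár single-component bound from Kollár's three classical theorems.**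
For `K` algebraically closed, `f ∈ K[X₀,X₁,X₂]` irreducible of degree `d ≥ 3` with
`char K = 0` or `d < char K`, disjoint finite families `L, M` of lines on `{f = 0}` and a finite
set `I` of points each lying on a line of `L` and a line of `M`:
`|I| ≤ 66 (d³ + d|L| + |M|)` — exactly the hypothesis `GKK` of
`Literature.Combinatorics.Additive.stevensDeZeeuw_thm4_of_componentBound_closed` — PROVIDED

* `H13` (**Monge–Salmon–Cayley**, [Kollar2015, Thm. 13; char. `p` with `d < p`: ¶38–39,
  Cor. 40]): `f` irreducible of degree `d ≥ 3` (`char K = 0` or `d < char K`) and `{f = 0}` not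
  ruled (some point of the surface lies on no line of the surface) `⟹` some `g` with `f ∤ g`,
  `deg g ≤ 11 d`, vanishing on every line of `{f = 0}`;
* `H14` ([Kollar2015, Prop. 14 (2)]): `f` irreducible, `f ∤ g`, `Λ` a finite family of lines on
  `{f = 0} ∩ {g = 0}`, `P` a finite set of points on lines of `Λ`, `r(p) = #{ℓ ∈ Λ : p ∈ ℓ}`
  `⟹ ∑_{p ∈ P} (r(p) - 1) ≤ ½ab(a+b-2)`, `a = deg f`, `b = deg g`;
* `H55` ([Kollar2015, Prop. 55 (4), (5) and ¶54]): `f` irreducible of degree `d ≥ 3`, `{f = 0}`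
  ruled, not a cone (no translate of `f` is a form of degree `d`) and not a cylinder (`f` is not
  translation-invariant in a nonzero direction) `⟹` there is a set `E` of at most two lines such
  that every line `ℓ ∉ E` of the surface carries at most `d - 2` points lying on another line
  `ℓ' ∉ E` of the surface.

The proof is Kollár's case distinction [Kollar2015, §2 (20), Cor. 21]: a cone carries at most one
such point (`card_le_one_of_cone`), a cylinder none (`card_eq_zero_of_cylinder`), any other ruled
surface at most `d|L| + 2|M|` (`H55`: a non-special line of `L` carries `≤ d - 2` points on
non-special lines of `M` and `≤ 2` on the special ones; a special line of `L` carries `≤ |M|`),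
and a non-ruled surface at most `½·d·11d·(12d - 2) ≤ 66d³` (`H13`, then `H14` for `Λ = L ∪ M`:
every point of `I` has `r(p) ≥ 2`). [cite: Kollar2015, §2 (20) and Corollary 21] -/
theorem componentBound_closed_of_kollar
    (H13 : ∀ (K : Type) [Field K] [IsAlgClosed K] (f : MvPolynomial (Fin 3) K),
      Irreducible f → 3 ≤ f.totalDegree → (ringChar K = 0 ∨ f.totalDegree < ringChar K) →
      (¬ ∀ p : Fin 3 → K, eval p f = 0 →
          ∃ ℓ : AffineSubspace K (Fin 3 → K), Module.finrank K ℓ.direction = 1 ∧ p ∈ ℓ ∧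
            ∀ q ∈ ℓ, eval q f = 0) →
      ∃ g : MvPolynomial (Fin 3) K, ¬ f ∣ g ∧ g.totalDegree ≤ 11 * f.totalDegree ∧
        ∀ ℓ : AffineSubspace K (Fin 3 → K), Module.finrank K ℓ.direction = 1 →
          (∀ q ∈ ℓ, eval q f = 0) → ∀ q ∈ ℓ, eval q g = 0)
    (H14 : ∀ (K : Type) [Field K] [IsAlgClosed K] (f g : MvPolynomial (Fin 3) K),
      Irreducible f → ¬ f ∣ g →
      ∀ Λ : Finset (AffineSubspace K (Fin 3 → K)),
        (∀ ℓ ∈ Λ, Module.finrank K ℓ.direction = 1) →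
        (∀ ℓ ∈ Λ, ∀ q ∈ ℓ, eval q f = 0) → (∀ ℓ ∈ Λ, ∀ q ∈ ℓ, eval q g = 0) →
        ∀ P : Finset (Fin 3 → K), (∀ p ∈ P, ∃ ℓ ∈ Λ, p ∈ ℓ) →
          (∑ p ∈ P, (((Λ.filter fun ℓ => p ∈ ℓ).card : ℝ) - 1)) ≤
            (1 / 2 : ℝ) * f.totalDegree * g.totalDegree *
              ((f.totalDegree : ℝ) + g.totalDegree - 2))
    (H55 : ∀ (K : Type) [Field K] [IsAlgClosed K] (f : MvPolynomial (Fin 3) K),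
      Irreducible f → 3 ≤ f.totalDegree →
      (∀ p : Fin 3 → K, eval p f = 0 →
          ∃ ℓ : AffineSubspace K (Fin 3 → K), Module.finrank K ℓ.direction = 1 ∧ p ∈ ℓ ∧
            ∀ q ∈ ℓ, eval q f = 0) →
      (¬ ∃ p : Fin 3 → K, (translate p f).IsHomogeneous f.totalDegree) →
      (¬ ∃ v : Fin 3 → K, v ≠ 0 ∧ ∀ (p : Fin 3 → K) (t : K), eval (p + t • v) f = eval p f) →
      ∃ E : Finset (AffineSubspace K (Fin 3 → K)), E.card ≤ 2 ∧
        ∀ ℓ : AffineSubspace K (Fin 3 → K), Module.finrank K ℓ.direction = 1 →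
          (∀ q ∈ ℓ, eval q f = 0) → ℓ ∉ E →
          ∀ P : Finset (Fin 3 → K),
            (∀ p ∈ P, p ∈ ℓ ∧ ∃ ℓ' : AffineSubspace K (Fin 3 → K),
                Module.finrank K ℓ'.direction = 1 ∧ (∀ q ∈ ℓ', eval q f = 0) ∧
                ℓ' ≠ ℓ ∧ ℓ' ∉ E ∧ p ∈ ℓ') →
            P.card + 2 ≤ f.totalDegree) :
    ∃ CK : ℝ, 0 < CK ∧ ∀ (K : Type) [Field K] [IsAlgClosed K] (f : MvPolynomial (Fin 3) K),
      Irreducible f → 3 ≤ f.totalDegree → (ringChar K = 0 ∨ f.totalDegree < ringChar K) →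
      ∀ (L M : Finset (AffineSubspace K (Fin 3 → K))),
        (∀ ℓ ∈ L, Module.finrank K ℓ.direction = 1) →
        (∀ m ∈ M, Module.finrank K m.direction = 1) → Disjoint L M →
        (∀ ℓ ∈ L, ∀ z ∈ ℓ, MvPolynomial.eval z f = 0) →
        (∀ m ∈ M, ∀ z ∈ m, MvPolynomial.eval z f = 0) →
        ∀ I : Finset (Fin 3 → K), (∀ z ∈ I, (∃ ℓ ∈ L, z ∈ ℓ) ∧ (∃ m ∈ M, z ∈ m)) →
          (I.card : ℝ) ≤ CK * ((f.totalDegree : ℝ) ^ 3 + f.totalDegree * L.card + M.card) := by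
  refine ⟨66, by norm_num, ?_⟩
  intro K _ _ f hf hd hchar L M hL hM hLM hLf hMf I hI
  have hd0 : (0 : ℝ) ≤ f.totalDegree := Nat.cast_nonneg _
  have hL0 : (0 : ℝ) ≤ L.card := Nat.cast_nonneg _
  have hM0 : (0 : ℝ) ≤ M.card := Nat.cast_nonneg _
  have hd3 : (3 : ℝ) ≤ f.totalDegree := by exact_mod_cast hd
  have hd27 : (27 : ℝ) ≤ (f.totalDegree : ℝ) ^ 3 :=
    calc (27 : ℝ) = 3 ^ 3 := by norm_num
      _ ≤ (f.totalDegree : ℝ) ^ 3 := pow_le_pow_left₀ (by norm_num) hd3 3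
  by_cases hruled : ∀ p : Fin 3 → K, eval p f = 0 →
      ∃ ℓ : AffineSubspace K (Fin 3 → K), Module.finrank K ℓ.direction = 1 ∧ p ∈ ℓ ∧
        ∀ q ∈ ℓ, eval q f = 0
  swap
  · /- NON-RULED: Theorem 13 gives `g`; Proposition 14 (2) for `Λ = L ∪ M`, `P = I`
      [Kollar2015, Cor. 21]. -/
    obtain ⟨g, hfg, hgdeg, hg⟩ := H13 K f hf hd hchar hruled
    have hΛ1 : ∀ ℓ ∈ L ∪ M, Module.finrank K ℓ.direction = 1 := by
      intro ℓ hℓ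
      rcases Finset.mem_union.1 hℓ with h | h
      exacts [hL ℓ h, hM ℓ h]
    have hΛf : ∀ ℓ ∈ L ∪ M, ∀ q ∈ ℓ, eval q f = 0 := by
      intro ℓ hℓ
      rcases Finset.mem_union.1 hℓ with h | h
      exacts [hLf ℓ h, hMf ℓ h]
    have hΛg : ∀ ℓ ∈ L ∪ M, ∀ q ∈ ℓ, eval q g = 0 := fun ℓ hℓ =>
      hg ℓ (hΛ1 ℓ hℓ) (hΛf ℓ hℓ)
    have hIΛ : ∀ p ∈ I, ∃ ℓ ∈ L ∪ M, p ∈ ℓ := by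
      intro p hp
      obtain ⟨⟨ℓ, hℓ, hpℓ⟩, -⟩ := hI p hp
      exact ⟨ℓ, Finset.mem_union.2 (Or.inl hℓ), hpℓ⟩
    have h14 := H14 K f g hf hfg (L ∪ M) hΛ1 hΛf hΛg I hIΛ
    -- every point of `I` lies on at least two lines of `L ∪ M`
    have hge : ∀ p ∈ I, (2 : ℝ) ≤ ((L ∪ M).filter fun ℓ => p ∈ ℓ).card := by
      intro p hp
      obtain ⟨⟨ℓ, hℓ, hpℓ⟩, ⟨m, hm, hpm⟩⟩ := hI p hp
      have hne : ℓ ≠ m := fun h => Finset.disjoint_left.1 hLM hℓ (h ▸ hm)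
      have hsub : ({ℓ, m} : Finset (AffineSubspace K (Fin 3 → K))) ⊆
          (L ∪ M).filter fun ℓ => p ∈ ℓ := by
        intro x hx
        rw [Finset.mem_insert, Finset.mem_singleton] at hx
        rw [Finset.mem_filter, Finset.mem_union]
        rcases hx with rfl | rfl
        · exact ⟨Or.inl hℓ, hpℓ⟩
        · exact ⟨Or.inr hm, hpm⟩
      have hcard := Finset.card_le_card hsub
      rw [Finset.card_pair hne] at hcard
      exact_mod_cast hcard
    have hIle : (I.card : ℝ) ≤ ∑ p ∈ I, ((((L ∪ M).filter fun ℓ => p ∈ ℓ).card : ℝ) - 1) := by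
      have h1 : (I.card : ℝ) = ∑ p ∈ I, (1 : ℝ) := by simp
      rw [h1]
      exact Finset.sum_le_sum fun p hp => by linarith [hge p hp]
    have hb : (g.totalDegree : ℝ) ≤ 11 * f.totalDegree := by exact_mod_cast hgdeg
    have hb0 : (0 : ℝ) ≤ g.totalDegree := Nat.cast_nonneg _
    -- `½ d b (d + b - 2) ≤ 66 d³` for `0 ≤ b ≤ 11 d`
    have key : (1 / 2 : ℝ) * f.totalDegree * g.totalDegree *
        ((f.totalDegree : ℝ) + g.totalDegree - 2) ≤ 66 * (f.totalDegree : ℝ) ^ 3 := by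
      have hpos : (0 : ℝ) ≤ (f.totalDegree : ℝ) + g.totalDegree - 2 := by linarith
      have h12 : (f.totalDegree : ℝ) + g.totalDegree - 2 ≤ 12 * f.totalDegree := by linarith
      have h1 : (g.totalDegree : ℝ) * ((f.totalDegree : ℝ) + g.totalDegree - 2) ≤
          (11 * f.totalDegree) * (12 * f.totalDegree) :=
        calc (g.totalDegree : ℝ) * ((f.totalDegree : ℝ) + g.totalDegree - 2)
            ≤ (11 * f.totalDegree) * ((f.totalDegree : ℝ) + g.totalDegree - 2) :=
              mul_le_mul_of_nonneg_right hb hpos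
          _ ≤ (11 * f.totalDegree) * (12 * f.totalDegree) :=
              mul_le_mul_of_nonneg_left h12 (by linarith)
      calc (1 / 2 : ℝ) * f.totalDegree * g.totalDegree * ((f.totalDegree : ℝ) + g.totalDegree - 2)
          = (1 / 2 : ℝ) * f.totalDegree *
              ((g.totalDegree : ℝ) * ((f.totalDegree : ℝ) + g.totalDegree - 2)) := by ring
        _ ≤ (1 / 2 : ℝ) * f.totalDegree * ((11 * f.totalDegree) * (12 * f.totalDegree)) :=
              mul_le_mul_of_nonneg_left h1 (by linarith)
        _ = 66 * (f.totalDegree : ℝ) ^ 3 := by ring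
    calc (I.card : ℝ) ≤ _ := hIle
      _ ≤ _ := h14
      _ ≤ 66 * (f.totalDegree : ℝ) ^ 3 := key
      _ ≤ 66 * ((f.totalDegree : ℝ) ^ 3 + f.totalDegree * L.card + M.card) := by nlinarith
  · /- RULED. -/
    haveI : Infinite K := IsAlgClosed.instInfinite
    by_cases hcone : ∃ p : Fin 3 → K, (translate p f).IsHomogeneous f.totalDegree
    · -- a cone: all lines pass through the vertex [Kollar2015, §7 ¶54]
      obtain ⟨p, hp⟩ := hcone
      have h1 : I.card ≤ 1 := card_le_one_of_cone hf p hp (by omega) L M hL hM hLM hLf hMf I hI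
      have h1' : (I.card : ℝ) ≤ 1 := by exact_mod_cast h1
      nlinarith
    by_cases hcyl : ∃ v : Fin 3 → K, v ≠ 0 ∧ ∀ (p : Fin 3 → K) (t : K),
        eval (p + t • v) f = eval p f
    · -- a cylinder (cone with vertex at infinity): no such point at all
      obtain ⟨v, hv, hcv⟩ := hcyl
      have h0 : I.card = 0 :=
        card_eq_zero_of_cylinder hf (by omega) hv hcv L M hL hM hLM hLf hMf I hI
      rw [h0, Nat.cast_zero]
      nlinarith
    /- any other ruled surface: Proposition 55 (4), (5) [Kollar2015, §2 (20)]: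
      `|I| ≤ d |L| + 2 |M|`. -/
    obtain ⟨E, hE2, hE⟩ := H55 K f hf hd hruled hcone hcyl
    -- choose, for every point of `I`, a line of `M` through it
    have hMch : ∀ z ∈ I, ∃ m ∈ M, z ∈ m := fun z hz => (hI z hz).2
    choose! mOf hmOfM hzmOf using hMch
    -- on a fixed line `ℓ ∈ L`, distinct points of `I` have distinct chosen `M`-lines
    have hinj : ∀ ℓ ∈ L, Set.InjOn mOf ↑(I.filter fun z => z ∈ ℓ) := by
      intro ℓ hℓ z hz z' hz' heq
      rw [Finset.coe_filter] at hz hz'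
      obtain ⟨hzI, hzℓ⟩ := hz
      obtain ⟨hz'I, hz'ℓ⟩ := hz'
      have hne : ℓ ≠ mOf z := fun h => Finset.disjoint_left.1 hLM hℓ (h ▸ hmOfM z hzI)
      have hz'm : z' ∈ mOf z := by rw [heq]; exact hzmOf z' hz'I
      exact eq_of_mem_of_mem (hL ℓ hℓ) (hM _ (hmOfM z hzI)) hne hzℓ (hzmOf z hzI) hz'ℓ hz'm
    -- points of `I ∩ ℓ` whose chosen `M`-line lies in a set `T` number at most `|T|`
    have hcount : ∀ ℓ ∈ L, ∀ T : Finset (AffineSubspace K (Fin 3 → K)),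
        ((I.filter fun z => z ∈ ℓ).filter fun z => mOf z ∈ T).card ≤ T.card := by
      intro ℓ hℓ T
      have hinj' : Set.InjOn mOf ↑((I.filter fun z => z ∈ ℓ).filter fun z => mOf z ∈ T) :=
        (hinj ℓ hℓ).mono (by
          intro z hz
          exact Finset.mem_coe.2 (Finset.mem_filter.1 (Finset.mem_coe.1 hz)).1)
      calc ((I.filter fun z => z ∈ ℓ).filter fun z => mOf z ∈ T).card
          = (((I.filter fun z => z ∈ ℓ).filter fun z => mOf z ∈ T).image mOf).card :=
            (Finset.card_image_of_injOn hinj').symm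
        _ ≤ T.card := Finset.card_le_card (by
            intro m hm
            rw [Finset.mem_image] at hm
            obtain ⟨z, hz, rfl⟩ := hm
            exact (Finset.mem_filter.1 hz).2)
    -- per-line bounds
    have hline : ∀ ℓ ∈ L,
        (I.filter fun z => z ∈ ℓ).card ≤ if ℓ ∈ E then M.card else f.totalDegree := by
      intro ℓ hℓ
      split_ifs with hℓE
      · -- a special line of `L`: inject its points into `M`
        calc (I.filter fun z => z ∈ ℓ).card
            = ((I.filter fun z => z ∈ ℓ).filter fun z => mOf z ∈ M).card := by
              congr 1
              refine (Finset.filter_true_of_mem ?_).symm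
              intro z hz
              exact hmOfM z (Finset.mem_filter.1 hz).1
          _ ≤ M.card := hcount ℓ hℓ M
      · -- a non-special line of `L`: `≤ d - 2` points on non-special `M`-lines (H55),
        -- `≤ 2` points on the special ones
        have hA : ((I.filter fun z => z ∈ ℓ).filter fun z => mOf z ∉ E).card + 2 ≤
            f.totalDegree := by
          refine hE ℓ (hL ℓ hℓ) (hLf ℓ hℓ) hℓE _ ?_
          intro z hz
          rw [Finset.mem_filter, Finset.mem_filter] at hz
          obtain ⟨⟨hzI, hzℓ⟩, hmE⟩ := hz
          refine ⟨hzℓ, mOf z, hM _ (hmOfM z hzI), hMf _ (hmOfM z hzI), ?_, hmE, hzmOf z hzI⟩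
          exact fun h => Finset.disjoint_left.1 hLM hℓ (h ▸ hmOfM z hzI)
        have hB : ((I.filter fun z => z ∈ ℓ).filter fun z => mOf z ∈ E).card ≤ 2 :=
          (hcount ℓ hℓ E).trans hE2
        have hsplit : (I.filter fun z => z ∈ ℓ).card ≤
            ((I.filter fun z => z ∈ ℓ).filter fun z => mOf z ∉ E).card +
              ((I.filter fun z => z ∈ ℓ).filter fun z => mOf z ∈ E).card :=
          calc (I.filter fun z => z ∈ ℓ).card
              ≤ (((I.filter fun z => z ∈ ℓ).filter fun z => mOf z ∉ E) ∪
                  ((I.filter fun z => z ∈ ℓ).filter fun z => mOf z ∈ E)).card :=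
                Finset.card_le_card (by
                  intro z hz
                  by_cases h : mOf z ∈ E
                  · exact Finset.mem_union_right _ (Finset.mem_filter.2 ⟨hz, h⟩)
                  · exact Finset.mem_union_left _ (Finset.mem_filter.2 ⟨hz, h⟩))
            _ ≤ _ := Finset.card_union_le _ _
        omega
    -- add up over the lines of `L`
    have hcover : I ⊆ L.biUnion fun ℓ => I.filter fun z => z ∈ ℓ := by
      intro z hz
      obtain ⟨⟨ℓ, hℓ, hzℓ⟩, -⟩ := hI z hz
      exact Finset.mem_biUnion.2 ⟨ℓ, hℓ, Finset.mem_filter.2 ⟨hz, hzℓ⟩⟩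
    have hLE : (L.filter fun ℓ => ℓ ∈ E).card ≤ 2 :=
      (Finset.card_le_card fun ℓ hℓ => (Finset.mem_filter.1 hℓ).2).trans hE2
    have hnat : I.card ≤ f.totalDegree * L.card + 2 * M.card :=
      calc I.card ≤ (L.biUnion fun ℓ => I.filter fun z => z ∈ ℓ).card :=
            Finset.card_le_card hcover
        _ ≤ ∑ ℓ ∈ L, (I.filter fun z => z ∈ ℓ).card := Finset.card_biUnion_le
        _ ≤ ∑ ℓ ∈ L, (if ℓ ∈ E then M.card else f.totalDegree) := Finset.sum_le_sum hline
        _ = ∑ ℓ ∈ L.filter (fun ℓ => ℓ ∈ E), M.card +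
              ∑ ℓ ∈ L.filter (fun ℓ => ¬ ℓ ∈ E), f.totalDegree := Finset.sum_ite _ _
        _ = (L.filter fun ℓ => ℓ ∈ E).card * M.card +
              (L.filter fun ℓ => ¬ ℓ ∈ E).card * f.totalDegree := by
            rw [Finset.sum_const, Finset.sum_const, smul_eq_mul, smul_eq_mul]
        _ ≤ 2 * M.card + L.card * f.totalDegree := by
            gcongr
            exact Finset.filter_subset _ _
        _ = f.totalDegree * L.card + 2 * M.card := by ring
    have hreal : (I.card : ℝ) ≤ f.totalDegree * L.card + 2 * M.card := by exact_mod_cast hnat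
    nlinarith

/-- **Stevens–de Zeeuw, Theorem 4, from Kollár's Theorem 13, Proposition 14 (2) and
Proposition 55.** The named fact `Literature.Combinatorics.Additive.stevensDeZeeuw_thm4`
(point–line incidences on Cartesian products over arbitrary fields) follows from the three
classical theorems `H13` (Monge–Salmon–Cayley, [Kollar2015, Thm. 13, ¶38–40]), `H14`
([Kollar2015, Prop. 14 (2)]) and `H55` ([Kollar2015, Prop. 55 (4), (5), ¶54]) stated as in
`componentBound_closed_of_kollar`, via that theorem and the proved chain
`stevensDeZeeuw_thm4_of_componentBound_closed` (de Zeeuw 2016, Lemma 3.1 and Theorem 1.1;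
Stevens–de Zeeuw 2017, §2). These three theorems are now the complete list of unformalized
inputs of Stevens–de Zeeuw's Theorem 4. [cite: StevensDeZeeuw2017, Theorem 4] -/
theorem stevensDeZeeuw_thm4_of_kollar
    (H13 : ∀ (K : Type) [Field K] [IsAlgClosed K] (f : MvPolynomial (Fin 3) K),
      Irreducible f → 3 ≤ f.totalDegree → (ringChar K = 0 ∨ f.totalDegree < ringChar K) →
      (¬ ∀ p : Fin 3 → K, eval p f = 0 →
          ∃ ℓ : AffineSubspace K (Fin 3 → K), Module.finrank K ℓ.direction = 1 ∧ p ∈ ℓ ∧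
            ∀ q ∈ ℓ, eval q f = 0) →
      ∃ g : MvPolynomial (Fin 3) K, ¬ f ∣ g ∧ g.totalDegree ≤ 11 * f.totalDegree ∧
        ∀ ℓ : AffineSubspace K (Fin 3 → K), Module.finrank K ℓ.direction = 1 →
          (∀ q ∈ ℓ, eval q f = 0) → ∀ q ∈ ℓ, eval q g = 0)
    (H14 : ∀ (K : Type) [Field K] [IsAlgClosed K] (f g : MvPolynomial (Fin 3) K),
      Irreducible f → ¬ f ∣ g →
      ∀ Λ : Finset (AffineSubspace K (Fin 3 → K)),
        (∀ ℓ ∈ Λ, Module.finrank K ℓ.direction = 1) →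
        (∀ ℓ ∈ Λ, ∀ q ∈ ℓ, eval q f = 0) → (∀ ℓ ∈ Λ, ∀ q ∈ ℓ, eval q g = 0) →
        ∀ P : Finset (Fin 3 → K), (∀ p ∈ P, ∃ ℓ ∈ Λ, p ∈ ℓ) →
          (∑ p ∈ P, (((Λ.filter fun ℓ => p ∈ ℓ).card : ℝ) - 1)) ≤
            (1 / 2 : ℝ) * f.totalDegree * g.totalDegree *
              ((f.totalDegree : ℝ) + g.totalDegree - 2))
    (H55 : ∀ (K : Type) [Field K] [IsAlgClosed K] (f : MvPolynomial (Fin 3) K),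
      Irreducible f → 3 ≤ f.totalDegree →
      (∀ p : Fin 3 → K, eval p f = 0 →
          ∃ ℓ : AffineSubspace K (Fin 3 → K), Module.finrank K ℓ.direction = 1 ∧ p ∈ ℓ ∧
            ∀ q ∈ ℓ, eval q f = 0) →
      (¬ ∃ p : Fin 3 → K, (translate p f).IsHomogeneous f.totalDegree) →
      (¬ ∃ v : Fin 3 → K, v ≠ 0 ∧ ∀ (p : Fin 3 → K) (t : K), eval (p + t • v) f = eval p f) →
      ∃ E : Finset (AffineSubspace K (Fin 3 → K)), E.card ≤ 2 ∧
        ∀ ℓ : AffineSubspace K (Fin 3 → K), Module.finrank K ℓ.direction = 1 →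
          (∀ q ∈ ℓ, eval q f = 0) → ℓ ∉ E →
          ∀ P : Finset (Fin 3 → K),
            (∀ p ∈ P, p ∈ ℓ ∧ ∃ ℓ' : AffineSubspace K (Fin 3 → K),
                Module.finrank K ℓ'.direction = 1 ∧ (∀ q ∈ ℓ', eval q f = 0) ∧
                ℓ' ≠ ℓ ∧ ℓ' ∉ E ∧ p ∈ ℓ') →
            P.card + 2 ≤ f.totalDegree) :
    Literature.Combinatorics.Additive.stevensDeZeeuw_thm4 :=
  Literature.Combinatorics.Additive.stevensDeZeeuw_thm4_of_componentBound_closed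
    (componentBound_closed_of_kollar H13 H14 H55)

end ComponentBound

/-! ### Variant at the generic point (appended)

The dichotomy "ruled / not ruled" of `componentBound_closed_of_kollar` asks for a line through
EVERY point. An elementary (function-field) proof of the Monge–Salmon–Cayley theorem produces
lines only through the points of a dense open subset `{f = 0} ∖ {h = 0}`; the variant below runs
the same case distinction on "generically ruled" and relaxes the degree of the auxiliary surface
to `17 d` (the degree of a chart flecnode polynomial). The glue is unchanged; only the constant
becomes `C_K = 153`.
-/

section GenericComponentBound

open scoped Classical

/-- **The component bound from the three classical theorems, generic-point form.** The same
reduction as `componentBound_closed_of_kollar` (constant `C_K = 153`), with "ruled" replaced by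
**generically ruled** — *some* `h ∉ (f)` such that every point of `{f = 0} ∖ {h = 0}` lies on a
line of the surface — in both `H13` and `H55`, and with the degree bound of `H13` relaxed to
`deg g ≤ 17 d`. Both hypotheses are still implied by the printed theorems: a ruled surface in
Kollár's sense has a line through EVERY point [Kollar2015, Def. 52], so "not generically ruled"
implies "no ruled component" (Thm. 13, `deg T = 11d - 24 ≤ 17d`); and a generically ruled
irreducible surface contains infinitely many lines, hence is ruled [Kollar2015, Prop. 53], so
Prop. 55 applies. This is the form an elementary proof of the Monge–Salmon–Cayley theorem
naturally delivers (a chart flecnode polynomial has degree `≤ 17d - 24`, and its vanishing on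
the surface yields lines through the points of a dense open subset), recorded so that `H13`,
`H55` can be discharged in that form. [cite: Kollar2015, §2 (20) and Corollary 21] -/
theorem componentBound_closed_of_kollar_generic
    (H13 : ∀ (K : Type) [Field K] [IsAlgClosed K] (f : MvPolynomial (Fin 3) K),
      Irreducible f → 3 ≤ f.totalDegree → (ringChar K = 0 ∨ f.totalDegree < ringChar K) →
      (¬ ∃ h : MvPolynomial (Fin 3) K, ¬ f ∣ h ∧ ∀ p : Fin 3 → K, eval p f = 0 →
          eval p h ≠ 0 → ∃ ℓ : AffineSubspace K (Fin 3 → K),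
            Module.finrank K ℓ.direction = 1 ∧ p ∈ ℓ ∧ ∀ q ∈ ℓ, eval q f = 0) →
      ∃ g : MvPolynomial (Fin 3) K, ¬ f ∣ g ∧ g.totalDegree ≤ 17 * f.totalDegree ∧
        ∀ ℓ : AffineSubspace K (Fin 3 → K), Module.finrank K ℓ.direction = 1 →
          (∀ q ∈ ℓ, eval q f = 0) → ∀ q ∈ ℓ, eval q g = 0)
    (H14 : ∀ (K : Type) [Field K] [IsAlgClosed K] (f g : MvPolynomial (Fin 3) K),
      Irreducible f → ¬ f ∣ g →
      ∀ Λ : Finset (AffineSubspace K (Fin 3 → K)),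
        (∀ ℓ ∈ Λ, Module.finrank K ℓ.direction = 1) →
        (∀ ℓ ∈ Λ, ∀ q ∈ ℓ, eval q f = 0) → (∀ ℓ ∈ Λ, ∀ q ∈ ℓ, eval q g = 0) →
        ∀ P : Finset (Fin 3 → K), (∀ p ∈ P, ∃ ℓ ∈ Λ, p ∈ ℓ) →
          (∑ p ∈ P, (((Λ.filter fun ℓ => p ∈ ℓ).card : ℝ) - 1)) ≤
            (1 / 2 : ℝ) * f.totalDegree * g.totalDegree *
              ((f.totalDegree : ℝ) + g.totalDegree - 2))
    (H55 : ∀ (K : Type) [Field K] [IsAlgClosed K] (f : MvPolynomial (Fin 3) K),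
      Irreducible f → 3 ≤ f.totalDegree →
      (∃ h : MvPolynomial (Fin 3) K, ¬ f ∣ h ∧ ∀ p : Fin 3 → K, eval p f = 0 →
          eval p h ≠ 0 → ∃ ℓ : AffineSubspace K (Fin 3 → K),
            Module.finrank K ℓ.direction = 1 ∧ p ∈ ℓ ∧ ∀ q ∈ ℓ, eval q f = 0) →
      (¬ ∃ p : Fin 3 → K, (translate p f).IsHomogeneous f.totalDegree) →
      (¬ ∃ v : Fin 3 → K, v ≠ 0 ∧ ∀ (p : Fin 3 → K) (t : K), eval (p + t • v) f = eval p f) →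
      ∃ E : Finset (AffineSubspace K (Fin 3 → K)), E.card ≤ 2 ∧
        ∀ ℓ : AffineSubspace K (Fin 3 → K), Module.finrank K ℓ.direction = 1 →
          (∀ q ∈ ℓ, eval q f = 0) → ℓ ∉ E →
          ∀ P : Finset (Fin 3 → K),
            (∀ p ∈ P, p ∈ ℓ ∧ ∃ ℓ' : AffineSubspace K (Fin 3 → K),
                Module.finrank K ℓ'.direction = 1 ∧ (∀ q ∈ ℓ', eval q f = 0) ∧
                ℓ' ≠ ℓ ∧ ℓ' ∉ E ∧ p ∈ ℓ') →
            P.card + 2 ≤ f.totalDegree) :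
    ∃ CK : ℝ, 0 < CK ∧ ∀ (K : Type) [Field K] [IsAlgClosed K] (f : MvPolynomial (Fin 3) K),
      Irreducible f → 3 ≤ f.totalDegree → (ringChar K = 0 ∨ f.totalDegree < ringChar K) →
      ∀ (L M : Finset (AffineSubspace K (Fin 3 → K))),
        (∀ ℓ ∈ L, Module.finrank K ℓ.direction = 1) →
        (∀ m ∈ M, Module.finrank K m.direction = 1) → Disjoint L M →
        (∀ ℓ ∈ L, ∀ z ∈ ℓ, MvPolynomial.eval z f = 0) →
        (∀ m ∈ M, ∀ z ∈ m, MvPolynomial.eval z f = 0) →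
        ∀ I : Finset (Fin 3 → K), (∀ z ∈ I, (∃ ℓ ∈ L, z ∈ ℓ) ∧ (∃ m ∈ M, z ∈ m)) →
          (I.card : ℝ) ≤ CK * ((f.totalDegree : ℝ) ^ 3 + f.totalDegree * L.card + M.card) := by
  refine ⟨153, by norm_num, ?_⟩
  intro K _ _ f hf hd hchar L M hL hM hLM hLf hMf I hI
  have hd0 : (0 : ℝ) ≤ f.totalDegree := Nat.cast_nonneg _
  have hL0 : (0 : ℝ) ≤ L.card := Nat.cast_nonneg _
  have hM0 : (0 : ℝ) ≤ M.card := Nat.cast_nonneg _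
  have hd3 : (3 : ℝ) ≤ f.totalDegree := by exact_mod_cast hd
  have hd27 : (27 : ℝ) ≤ (f.totalDegree : ℝ) ^ 3 :=
    calc (27 : ℝ) = 3 ^ 3 := by norm_num
      _ ≤ (f.totalDegree : ℝ) ^ 3 := pow_le_pow_left₀ (by norm_num) hd3 3
  by_cases hruled : ∃ h : MvPolynomial (Fin 3) K, ¬ f ∣ h ∧ ∀ p : Fin 3 → K, eval p f = 0 →
      eval p h ≠ 0 → ∃ ℓ : AffineSubspace K (Fin 3 → K),
        Module.finrank K ℓ.direction = 1 ∧ p ∈ ℓ ∧ ∀ q ∈ ℓ, eval q f = 0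
  swap
  · /- NON-RULED: Theorem 13 gives `g`; Proposition 14 (2) for `Λ = L ∪ M`, `P = I`
      [Kollar2015, Cor. 21]. -/
    obtain ⟨g, hfg, hgdeg, hg⟩ := H13 K f hf hd hchar hruled
    have hΛ1 : ∀ ℓ ∈ L ∪ M, Module.finrank K ℓ.direction = 1 := by
      intro ℓ hℓ
      rcases Finset.mem_union.1 hℓ with h | h
      exacts [hL ℓ h, hM ℓ h]
    have hΛf : ∀ ℓ ∈ L ∪ M, ∀ q ∈ ℓ, eval q f = 0 := by
      intro ℓ hℓ
      rcases Finset.mem_union.1 hℓ with h | h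
      exacts [hLf ℓ h, hMf ℓ h]
    have hΛg : ∀ ℓ ∈ L ∪ M, ∀ q ∈ ℓ, eval q g = 0 := fun ℓ hℓ =>
      hg ℓ (hΛ1 ℓ hℓ) (hΛf ℓ hℓ)
    have hIΛ : ∀ p ∈ I, ∃ ℓ ∈ L ∪ M, p ∈ ℓ := by
      intro p hp
      obtain ⟨⟨ℓ, hℓ, hpℓ⟩, -⟩ := hI p hp
      exact ⟨ℓ, Finset.mem_union.2 (Or.inl hℓ), hpℓ⟩
    have h14 := H14 K f g hf hfg (L ∪ M) hΛ1 hΛf hΛg I hIΛ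
    -- every point of `I` lies on at least two lines of `L ∪ M`
    have hge : ∀ p ∈ I, (2 : ℝ) ≤ ((L ∪ M).filter fun ℓ => p ∈ ℓ).card := by
      intro p hp
      obtain ⟨⟨ℓ, hℓ, hpℓ⟩, ⟨m, hm, hpm⟩⟩ := hI p hp
      have hne : ℓ ≠ m := fun h => Finset.disjoint_left.1 hLM hℓ (h ▸ hm)
      have hsub : ({ℓ, m} : Finset (AffineSubspace K (Fin 3 → K))) ⊆
          (L ∪ M).filter fun ℓ => p ∈ ℓ := by
        intro x hx
        rw [Finset.mem_insert, Finset.mem_singleton] at hx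
        rw [Finset.mem_filter, Finset.mem_union]
        rcases hx with rfl | rfl
        · exact ⟨Or.inl hℓ, hpℓ⟩
        · exact ⟨Or.inr hm, hpm⟩
      have hcard := Finset.card_le_card hsub
      rw [Finset.card_pair hne] at hcard
      exact_mod_cast hcard
    have hIle : (I.card : ℝ) ≤ ∑ p ∈ I, ((((L ∪ M).filter fun ℓ => p ∈ ℓ).card : ℝ) - 1) := by
      have h1 : (I.card : ℝ) = ∑ p ∈ I, (1 : ℝ) := by simp
      rw [h1]
      exact Finset.sum_le_sum fun p hp => by linarith [hge p hp]
    have hb : (g.totalDegree : ℝ) ≤ 17 * f.totalDegree := by exact_mod_cast hgdeg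
    have hb0 : (0 : ℝ) ≤ g.totalDegree := Nat.cast_nonneg _
    -- `½ d b (d + b - 2) ≤ 153 d³` for `0 ≤ b ≤ 17 d`
    have key : (1 / 2 : ℝ) * f.totalDegree * g.totalDegree *
        ((f.totalDegree : ℝ) + g.totalDegree - 2) ≤ 153 * (f.totalDegree : ℝ) ^ 3 := by
      have hpos : (0 : ℝ) ≤ (f.totalDegree : ℝ) + g.totalDegree - 2 := by linarith
      have h12 : (f.totalDegree : ℝ) + g.totalDegree - 2 ≤ 18 * f.totalDegree := by linarith
      have h1 : (g.totalDegree : ℝ) * ((f.totalDegree : ℝ) + g.totalDegree - 2) ≤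
          (17 * f.totalDegree) * (18 * f.totalDegree) :=
        calc (g.totalDegree : ℝ) * ((f.totalDegree : ℝ) + g.totalDegree - 2)
            ≤ (17 * f.totalDegree) * ((f.totalDegree : ℝ) + g.totalDegree - 2) :=
              mul_le_mul_of_nonneg_right hb hpos
          _ ≤ (17 * f.totalDegree) * (18 * f.totalDegree) :=
              mul_le_mul_of_nonneg_left h12 (by linarith)
      calc (1 / 2 : ℝ) * f.totalDegree * g.totalDegree * ((f.totalDegree : ℝ) + g.totalDegree - 2)
          = (1 / 2 : ℝ) * f.totalDegree *
              ((g.totalDegree : ℝ) * ((f.totalDegree : ℝ) + g.totalDegree - 2)) := by ring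
        _ ≤ (1 / 2 : ℝ) * f.totalDegree * ((17 * f.totalDegree) * (18 * f.totalDegree)) :=
              mul_le_mul_of_nonneg_left h1 (by linarith)
        _ = 153 * (f.totalDegree : ℝ) ^ 3 := by ring
    calc (I.card : ℝ) ≤ _ := hIle
      _ ≤ _ := h14
      _ ≤ 153 * (f.totalDegree : ℝ) ^ 3 := key
      _ ≤ 153 * ((f.totalDegree : ℝ) ^ 3 + f.totalDegree * L.card + M.card) := by nlinarith
  · /- RULED. -/
    haveI : Infinite K := IsAlgClosed.instInfinite
    by_cases hcone : ∃ p : Fin 3 → K, (translate p f).IsHomogeneous f.totalDegree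
    · -- a cone: all lines pass through the vertex [Kollar2015, §7 ¶54]
      obtain ⟨p, hp⟩ := hcone
      have h1 : I.card ≤ 1 := card_le_one_of_cone hf p hp (by omega) L M hL hM hLM hLf hMf I hI
      have h1' : (I.card : ℝ) ≤ 1 := by exact_mod_cast h1
      nlinarith
    by_cases hcyl : ∃ v : Fin 3 → K, v ≠ 0 ∧ ∀ (p : Fin 3 → K) (t : K),
        eval (p + t • v) f = eval p f
    · -- a cylinder (cone with vertex at infinity): no such point at all
      obtain ⟨v, hv, hcv⟩ := hcyl
      have h0 : I.card = 0 :=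
        card_eq_zero_of_cylinder hf (by omega) hv hcv L M hL hM hLM hLf hMf I hI
      rw [h0, Nat.cast_zero]
      nlinarith
    /- any other ruled surface: Proposition 55 (4), (5) [Kollar2015, §2 (20)]:
      `|I| ≤ d |L| + 2 |M|`. -/
    obtain ⟨E, hE2, hE⟩ := H55 K f hf hd hruled hcone hcyl
    -- choose, for every point of `I`, a line of `M` through it
    have hMch : ∀ z ∈ I, ∃ m ∈ M, z ∈ m := fun z hz => (hI z hz).2
    choose! mOf hmOfM hzmOf using hMch
    -- on a fixed line `ℓ ∈ L`, distinct points of `I` have distinct chosen `M`-lines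
    have hinj : ∀ ℓ ∈ L, Set.InjOn mOf ↑(I.filter fun z => z ∈ ℓ) := by
      intro ℓ hℓ z hz z' hz' heq
      rw [Finset.coe_filter] at hz hz'
      obtain ⟨hzI, hzℓ⟩ := hz
      obtain ⟨hz'I, hz'ℓ⟩ := hz'
      have hne : ℓ ≠ mOf z := fun h => Finset.disjoint_left.1 hLM hℓ (h ▸ hmOfM z hzI)
      have hz'm : z' ∈ mOf z := by rw [heq]; exact hzmOf z' hz'I
      exact eq_of_mem_of_mem (hL ℓ hℓ) (hM _ (hmOfM z hzI)) hne hzℓ (hzmOf z hzI) hz'ℓ hz'm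
    -- points of `I ∩ ℓ` whose chosen `M`-line lies in a set `T` number at most `|T|`
    have hcount : ∀ ℓ ∈ L, ∀ T : Finset (AffineSubspace K (Fin 3 → K)),
        ((I.filter fun z => z ∈ ℓ).filter fun z => mOf z ∈ T).card ≤ T.card := by
      intro ℓ hℓ T
      have hinj' : Set.InjOn mOf ↑((I.filter fun z => z ∈ ℓ).filter fun z => mOf z ∈ T) :=
        (hinj ℓ hℓ).mono (by
          intro z hz
          exact Finset.mem_coe.2 (Finset.mem_filter.1 (Finset.mem_coe.1 hz)).1)
      calc ((I.filter fun z => z ∈ ℓ).filter fun z => mOf z ∈ T).card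
          = (((I.filter fun z => z ∈ ℓ).filter fun z => mOf z ∈ T).image mOf).card :=
            (Finset.card_image_of_injOn hinj').symm
        _ ≤ T.card := Finset.card_le_card (by
            intro m hm
            rw [Finset.mem_image] at hm
            obtain ⟨z, hz, rfl⟩ := hm
            exact (Finset.mem_filter.1 hz).2)
    -- per-line bounds
    have hline : ∀ ℓ ∈ L,
        (I.filter fun z => z ∈ ℓ).card ≤ if ℓ ∈ E then M.card else f.totalDegree := by
      intro ℓ hℓ
      split_ifs with hℓE
      · -- a special line of `L`: inject its points into `M`
        calc (I.filter fun z => z ∈ ℓ).card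
            = ((I.filter fun z => z ∈ ℓ).filter fun z => mOf z ∈ M).card := by
              congr 1
              refine (Finset.filter_true_of_mem ?_).symm
              intro z hz
              exact hmOfM z (Finset.mem_filter.1 hz).1
          _ ≤ M.card := hcount ℓ hℓ M
      · -- a non-special line of `L`: `≤ d - 2` points on non-special `M`-lines (H55),
        -- `≤ 2` points on the special ones
        have hA : ((I.filter fun z => z ∈ ℓ).filter fun z => mOf z ∉ E).card + 2 ≤
            f.totalDegree := by
          refine hE ℓ (hL ℓ hℓ) (hLf ℓ hℓ) hℓE _ ?_
          intro z hz
          rw [Finset.mem_filter, Finset.mem_filter] at hz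
          obtain ⟨⟨hzI, hzℓ⟩, hmE⟩ := hz
          refine ⟨hzℓ, mOf z, hM _ (hmOfM z hzI), hMf _ (hmOfM z hzI), ?_, hmE, hzmOf z hzI⟩
          exact fun h => Finset.disjoint_left.1 hLM hℓ (h ▸ hmOfM z hzI)
        have hB : ((I.filter fun z => z ∈ ℓ).filter fun z => mOf z ∈ E).card ≤ 2 :=
          (hcount ℓ hℓ E).trans hE2
        have hsplit : (I.filter fun z => z ∈ ℓ).card ≤
            ((I.filter fun z => z ∈ ℓ).filter fun z => mOf z ∉ E).card +
              ((I.filter fun z => z ∈ ℓ).filter fun z => mOf z ∈ E).card :=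
          calc (I.filter fun z => z ∈ ℓ).card
              ≤ (((I.filter fun z => z ∈ ℓ).filter fun z => mOf z ∉ E) ∪
                  ((I.filter fun z => z ∈ ℓ).filter fun z => mOf z ∈ E)).card :=
                Finset.card_le_card (by
                  intro z hz
                  by_cases h : mOf z ∈ E
                  · exact Finset.mem_union_right _ (Finset.mem_filter.2 ⟨hz, h⟩)
                  · exact Finset.mem_union_left _ (Finset.mem_filter.2 ⟨hz, h⟩))
            _ ≤ _ := Finset.card_union_le _ _
        omega
    -- add up over the lines of `L`
    have hcover : I ⊆ L.biUnion fun ℓ => I.filter fun z => z ∈ ℓ := by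
      intro z hz
      obtain ⟨⟨ℓ, hℓ, hzℓ⟩, -⟩ := hI z hz
      exact Finset.mem_biUnion.2 ⟨ℓ, hℓ, Finset.mem_filter.2 ⟨hz, hzℓ⟩⟩
    have hLE : (L.filter fun ℓ => ℓ ∈ E).card ≤ 2 :=
      (Finset.card_le_card fun ℓ hℓ => (Finset.mem_filter.1 hℓ).2).trans hE2
    have hnat : I.card ≤ f.totalDegree * L.card + 2 * M.card :=
      calc I.card ≤ (L.biUnion fun ℓ => I.filter fun z => z ∈ ℓ).card :=
            Finset.card_le_card hcover
        _ ≤ ∑ ℓ ∈ L, (I.filter fun z => z ∈ ℓ).card := Finset.card_biUnion_le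
        _ ≤ ∑ ℓ ∈ L, (if ℓ ∈ E then M.card else f.totalDegree) := Finset.sum_le_sum hline
        _ = ∑ ℓ ∈ L.filter (fun ℓ => ℓ ∈ E), M.card +
              ∑ ℓ ∈ L.filter (fun ℓ => ¬ ℓ ∈ E), f.totalDegree := Finset.sum_ite _ _
        _ = (L.filter fun ℓ => ℓ ∈ E).card * M.card +
              (L.filter fun ℓ => ¬ ℓ ∈ E).card * f.totalDegree := by
            rw [Finset.sum_const, Finset.sum_const, smul_eq_mul, smul_eq_mul]
        _ ≤ 2 * M.card + L.card * f.totalDegree := by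
            gcongr
            exact Finset.filter_subset _ _
        _ = f.totalDegree * L.card + 2 * M.card := by ring
    have hreal : (I.card : ℝ) ≤ f.totalDegree * L.card + 2 * M.card := by exact_mod_cast hnat
    nlinarith

/-- **Stevens–de Zeeuw, Theorem 4, from the generic-point forms of Kollár's Theorem 13,
Proposition 14 (2) and Proposition 55** (see `componentBound_closed_of_kollar_generic`).
[cite: StevensDeZeeuw2017, Theorem 4] -/
theorem stevensDeZeeuw_thm4_of_kollar_generic
    (H13 : ∀ (K : Type) [Field K] [IsAlgClosed K] (f : MvPolynomial (Fin 3) K),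
      Irreducible f → 3 ≤ f.totalDegree → (ringChar K = 0 ∨ f.totalDegree < ringChar K) →
      (¬ ∃ h : MvPolynomial (Fin 3) K, ¬ f ∣ h ∧ ∀ p : Fin 3 → K, eval p f = 0 →
          eval p h ≠ 0 → ∃ ℓ : AffineSubspace K (Fin 3 → K),
            Module.finrank K ℓ.direction = 1 ∧ p ∈ ℓ ∧ ∀ q ∈ ℓ, eval q f = 0) →
      ∃ g : MvPolynomial (Fin 3) K, ¬ f ∣ g ∧ g.totalDegree ≤ 17 * f.totalDegree ∧
        ∀ ℓ : AffineSubspace K (Fin 3 → K), Module.finrank K ℓ.direction = 1 →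
          (∀ q ∈ ℓ, eval q f = 0) → ∀ q ∈ ℓ, eval q g = 0)
    (H14 : ∀ (K : Type) [Field K] [IsAlgClosed K] (f g : MvPolynomial (Fin 3) K),
      Irreducible f → ¬ f ∣ g →
      ∀ Λ : Finset (AffineSubspace K (Fin 3 → K)),
        (∀ ℓ ∈ Λ, Module.finrank K ℓ.direction = 1) →
        (∀ ℓ ∈ Λ, ∀ q ∈ ℓ, eval q f = 0) → (∀ ℓ ∈ Λ, ∀ q ∈ ℓ, eval q g = 0) →
        ∀ P : Finset (Fin 3 → K), (∀ p ∈ P, ∃ ℓ ∈ Λ, p ∈ ℓ) →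
          (∑ p ∈ P, (((Λ.filter fun ℓ => p ∈ ℓ).card : ℝ) - 1)) ≤
            (1 / 2 : ℝ) * f.totalDegree * g.totalDegree *
              ((f.totalDegree : ℝ) + g.totalDegree - 2))
    (H55 : ∀ (K : Type) [Field K] [IsAlgClosed K] (f : MvPolynomial (Fin 3) K),
      Irreducible f → 3 ≤ f.totalDegree →
      (∃ h : MvPolynomial (Fin 3) K, ¬ f ∣ h ∧ ∀ p : Fin 3 → K, eval p f = 0 →
          eval p h ≠ 0 → ∃ ℓ : AffineSubspace K (Fin 3 → K),
            Module.finrank K ℓ.direction = 1 ∧ p ∈ ℓ ∧ ∀ q ∈ ℓ, eval q f = 0) →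
      (¬ ∃ p : Fin 3 → K, (translate p f).IsHomogeneous f.totalDegree) →
      (¬ ∃ v : Fin 3 → K, v ≠ 0 ∧ ∀ (p : Fin 3 → K) (t : K), eval (p + t • v) f = eval p f) →
      ∃ E : Finset (AffineSubspace K (Fin 3 → K)), E.card ≤ 2 ∧
        ∀ ℓ : AffineSubspace K (Fin 3 → K), Module.finrank K ℓ.direction = 1 →
          (∀ q ∈ ℓ, eval q f = 0) → ℓ ∉ E →
          ∀ P : Finset (Fin 3 → K),
            (∀ p ∈ P, p ∈ ℓ ∧ ∃ ℓ' : AffineSubspace K (Fin 3 → K),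
                Module.finrank K ℓ'.direction = 1 ∧ (∀ q ∈ ℓ', eval q f = 0) ∧
                ℓ' ≠ ℓ ∧ ℓ' ∉ E ∧ p ∈ ℓ') →
            P.card + 2 ≤ f.totalDegree) :
    Literature.Combinatorics.Additive.stevensDeZeeuw_thm4 :=
  Literature.Combinatorics.Additive.stevensDeZeeuw_thm4_of_componentBound_closed
    (componentBound_closed_of_kollar_generic H13 H14 H55)

/-- **The component bound, generic-point form with a free degree constant.** As
`componentBound_closed_of_kollar_generic`, but the auxiliary surface of `H13` may have degree
`≤ c · d` for any fixed `c ≥ 1`; the constant becomes `C_K = (c + 1)²`. (The elementary chart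
flecnode polynomial `∂₂f · R₀₂ · R₁₂` of the function-field proof has degree `< 39 d`.)
[cite: Kollar2015, §2 (20) and Corollary 21] -/
theorem componentBound_closed_of_kollar_generic' (c : ℕ) (hc : 1 ≤ c)
    (H13 : ∀ (K : Type) [Field K] [IsAlgClosed K] (f : MvPolynomial (Fin 3) K),
      Irreducible f → 3 ≤ f.totalDegree → (ringChar K = 0 ∨ f.totalDegree < ringChar K) →
      (¬ ∃ h : MvPolynomial (Fin 3) K, ¬ f ∣ h ∧ ∀ p : Fin 3 → K, eval p f = 0 →
          eval p h ≠ 0 → ∃ ℓ : AffineSubspace K (Fin 3 → K),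
            Module.finrank K ℓ.direction = 1 ∧ p ∈ ℓ ∧ ∀ q ∈ ℓ, eval q f = 0) →
      ∃ g : MvPolynomial (Fin 3) K, ¬ f ∣ g ∧ g.totalDegree ≤ c * f.totalDegree ∧
        ∀ ℓ : AffineSubspace K (Fin 3 → K), Module.finrank K ℓ.direction = 1 →
          (∀ q ∈ ℓ, eval q f = 0) → ∀ q ∈ ℓ, eval q g = 0)
    (H14 : ∀ (K : Type) [Field K] [IsAlgClosed K] (f g : MvPolynomial (Fin 3) K),
      Irreducible f → ¬ f ∣ g →
      ∀ Λ : Finset (AffineSubspace K (Fin 3 → K)),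
        (∀ ℓ ∈ Λ, Module.finrank K ℓ.direction = 1) →
        (∀ ℓ ∈ Λ, ∀ q ∈ ℓ, eval q f = 0) → (∀ ℓ ∈ Λ, ∀ q ∈ ℓ, eval q g = 0) →
        ∀ P : Finset (Fin 3 → K), (∀ p ∈ P, ∃ ℓ ∈ Λ, p ∈ ℓ) →
          (∑ p ∈ P, (((Λ.filter fun ℓ => p ∈ ℓ).card : ℝ) - 1)) ≤
            (1 / 2 : ℝ) * f.totalDegree * g.totalDegree *
              ((f.totalDegree : ℝ) + g.totalDegree - 2))
    (H55 : ∀ (K : Type) [Field K] [IsAlgClosed K] (f : MvPolynomial (Fin 3) K),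
      Irreducible f → 3 ≤ f.totalDegree →
      (∃ h : MvPolynomial (Fin 3) K, ¬ f ∣ h ∧ ∀ p : Fin 3 → K, eval p f = 0 →
          eval p h ≠ 0 → ∃ ℓ : AffineSubspace K (Fin 3 → K),
            Module.finrank K ℓ.direction = 1 ∧ p ∈ ℓ ∧ ∀ q ∈ ℓ, eval q f = 0) →
      (¬ ∃ p : Fin 3 → K, (translate p f).IsHomogeneous f.totalDegree) →
      (¬ ∃ v : Fin 3 → K, v ≠ 0 ∧ ∀ (p : Fin 3 → K) (t : K), eval (p + t • v) f = eval p f) →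
      ∃ E : Finset (AffineSubspace K (Fin 3 → K)), E.card ≤ 2 ∧
        ∀ ℓ : AffineSubspace K (Fin 3 → K), Module.finrank K ℓ.direction = 1 →
          (∀ q ∈ ℓ, eval q f = 0) → ℓ ∉ E →
          ∀ P : Finset (Fin 3 → K),
            (∀ p ∈ P, p ∈ ℓ ∧ ∃ ℓ' : AffineSubspace K (Fin 3 → K),
                Module.finrank K ℓ'.direction = 1 ∧ (∀ q ∈ ℓ', eval q f = 0) ∧
                ℓ' ≠ ℓ ∧ ℓ' ∉ E ∧ p ∈ ℓ') →
            P.card + 2 ≤ f.totalDegree) :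
    ∃ CK : ℝ, 0 < CK ∧ ∀ (K : Type) [Field K] [IsAlgClosed K] (f : MvPolynomial (Fin 3) K),
      Irreducible f → 3 ≤ f.totalDegree → (ringChar K = 0 ∨ f.totalDegree < ringChar K) →
      ∀ (L M : Finset (AffineSubspace K (Fin 3 → K))),
        (∀ ℓ ∈ L, Module.finrank K ℓ.direction = 1) →
        (∀ m ∈ M, Module.finrank K m.direction = 1) → Disjoint L M →
        (∀ ℓ ∈ L, ∀ z ∈ ℓ, MvPolynomial.eval z f = 0) →
        (∀ m ∈ M, ∀ z ∈ m, MvPolynomial.eval z f = 0) →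
        ∀ I : Finset (Fin 3 → K), (∀ z ∈ I, (∃ ℓ ∈ L, z ∈ ℓ) ∧ (∃ m ∈ M, z ∈ m)) →
          (I.card : ℝ) ≤ CK * ((f.totalDegree : ℝ) ^ 3 + f.totalDegree * L.card + M.card) := by
  refine ⟨((c : ℝ) + 1) ^ 2, by positivity, ?_⟩
  intro K _ _ f hf hd hchar L M hL hM hLM hLf hMf I hI
  have hd0 : (0 : ℝ) ≤ f.totalDegree := Nat.cast_nonneg _
  have hL0 : (0 : ℝ) ≤ L.card := Nat.cast_nonneg _
  have hM0 : (0 : ℝ) ≤ M.card := Nat.cast_nonneg _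
  have hd3 : (3 : ℝ) ≤ f.totalDegree := by exact_mod_cast hd
  have hd27 : (27 : ℝ) ≤ (f.totalDegree : ℝ) ^ 3 :=
    calc (27 : ℝ) = 3 ^ 3 := by norm_num
      _ ≤ (f.totalDegree : ℝ) ^ 3 := pow_le_pow_left₀ (by norm_num) hd3 3
  have hc1 : (1 : ℝ) ≤ c := by exact_mod_cast hc
  have hCK4 : (4 : ℝ) ≤ ((c : ℝ) + 1) ^ 2 := by nlinarith
  have hS27 : (27 : ℝ) ≤ (f.totalDegree : ℝ) ^ 3 + f.totalDegree * L.card + M.card := by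
    nlinarith [mul_nonneg hd0 hL0]
  by_cases hruled : ∃ h : MvPolynomial (Fin 3) K, ¬ f ∣ h ∧ ∀ p : Fin 3 → K, eval p f = 0 →
      eval p h ≠ 0 → ∃ ℓ : AffineSubspace K (Fin 3 → K),
        Module.finrank K ℓ.direction = 1 ∧ p ∈ ℓ ∧ ∀ q ∈ ℓ, eval q f = 0
  swap
  · /- NON-RULED: Theorem 13 gives `g`; Proposition 14 (2) for `Λ = L ∪ M`, `P = I`
      [Kollar2015, Cor. 21]. -/
    obtain ⟨g, hfg, hgdeg, hg⟩ := H13 K f hf hd hchar hruled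
    have hΛ1 : ∀ ℓ ∈ L ∪ M, Module.finrank K ℓ.direction = 1 := by
      intro ℓ hℓ
      rcases Finset.mem_union.1 hℓ with h | h
      exacts [hL ℓ h, hM ℓ h]
    have hΛf : ∀ ℓ ∈ L ∪ M, ∀ q ∈ ℓ, eval q f = 0 := by
      intro ℓ hℓ
      rcases Finset.mem_union.1 hℓ with h | h
      exacts [hLf ℓ h, hMf ℓ h]
    have hΛg : ∀ ℓ ∈ L ∪ M, ∀ q ∈ ℓ, eval q g = 0 := fun ℓ hℓ =>
      hg ℓ (hΛ1 ℓ hℓ) (hΛf ℓ hℓ)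
    have hIΛ : ∀ p ∈ I, ∃ ℓ ∈ L ∪ M, p ∈ ℓ := by
      intro p hp
      obtain ⟨⟨ℓ, hℓ, hpℓ⟩, -⟩ := hI p hp
      exact ⟨ℓ, Finset.mem_union.2 (Or.inl hℓ), hpℓ⟩
    have h14 := H14 K f g hf hfg (L ∪ M) hΛ1 hΛf hΛg I hIΛ
    -- every point of `I` lies on at least two lines of `L ∪ M`
    have hge : ∀ p ∈ I, (2 : ℝ) ≤ ((L ∪ M).filter fun ℓ => p ∈ ℓ).card := by
      intro p hp
      obtain ⟨⟨ℓ, hℓ, hpℓ⟩, ⟨m, hm, hpm⟩⟩ := hI p hp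
      have hne : ℓ ≠ m := fun h => Finset.disjoint_left.1 hLM hℓ (h ▸ hm)
      have hsub : ({ℓ, m} : Finset (AffineSubspace K (Fin 3 → K))) ⊆
          (L ∪ M).filter fun ℓ => p ∈ ℓ := by
        intro x hx
        rw [Finset.mem_insert, Finset.mem_singleton] at hx
        rw [Finset.mem_filter, Finset.mem_union]
        rcases hx with rfl | rfl
        · exact ⟨Or.inl hℓ, hpℓ⟩
        · exact ⟨Or.inr hm, hpm⟩
      have hcard := Finset.card_le_card hsub
      rw [Finset.card_pair hne] at hcard
      exact_mod_cast hcard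
    have hIle : (I.card : ℝ) ≤ ∑ p ∈ I, ((((L ∪ M).filter fun ℓ => p ∈ ℓ).card : ℝ) - 1) := by
      have h1 : (I.card : ℝ) = ∑ p ∈ I, (1 : ℝ) := by simp
      rw [h1]
      exact Finset.sum_le_sum fun p hp => by linarith [hge p hp]
    have hb : (g.totalDegree : ℝ) ≤ c * f.totalDegree := by exact_mod_cast hgdeg
    have hb0 : (0 : ℝ) ≤ g.totalDegree := Nat.cast_nonneg _
    -- `½ d b (d + b - 2) ≤ ½ c (c + 1) d³ ≤ (c + 1)² d³` for `0 ≤ b ≤ c d`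
    have key : (1 / 2 : ℝ) * f.totalDegree * g.totalDegree *
        ((f.totalDegree : ℝ) + g.totalDegree - 2) ≤
          ((c : ℝ) + 1) ^ 2 * (f.totalDegree : ℝ) ^ 3 := by
      have hpos : (0 : ℝ) ≤ (f.totalDegree : ℝ) + g.totalDegree - 2 := by linarith
      have hcd : ((c : ℝ) + 1) * f.totalDegree = c * f.totalDegree + f.totalDegree := by ring
      have h12 : (f.totalDegree : ℝ) + g.totalDegree - 2 ≤ ((c : ℝ) + 1) * f.totalDegree := by
        rw [hcd]; linarith
      have h1 : (g.totalDegree : ℝ) * ((f.totalDegree : ℝ) + g.totalDegree - 2) ≤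
          (c * f.totalDegree) * (((c : ℝ) + 1) * f.totalDegree) :=
        calc (g.totalDegree : ℝ) * ((f.totalDegree : ℝ) + g.totalDegree - 2)
            ≤ (c * f.totalDegree) * ((f.totalDegree : ℝ) + g.totalDegree - 2) :=
              mul_le_mul_of_nonneg_right hb hpos
          _ ≤ (c * f.totalDegree) * (((c : ℝ) + 1) * f.totalDegree) :=
              mul_le_mul_of_nonneg_left h12 (by positivity)
      calc (1 / 2 : ℝ) * f.totalDegree * g.totalDegree * ((f.totalDegree : ℝ) + g.totalDegree - 2)
          = (1 / 2 : ℝ) * f.totalDegree *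
              ((g.totalDegree : ℝ) * ((f.totalDegree : ℝ) + g.totalDegree - 2)) := by ring
        _ ≤ (1 / 2 : ℝ) * f.totalDegree * ((c * f.totalDegree) * (((c : ℝ) + 1) * f.totalDegree)) :=
              mul_le_mul_of_nonneg_left h1 (by linarith)
        _ = ((c : ℝ) * (c + 1) / 2) * (f.totalDegree : ℝ) ^ 3 := by ring
        _ ≤ ((c : ℝ) + 1) ^ 2 * (f.totalDegree : ℝ) ^ 3 := by
              refine mul_le_mul_of_nonneg_right ?_ (by positivity)
              nlinarith
    calc (I.card : ℝ) ≤ _ := hIle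
      _ ≤ _ := h14
      _ ≤ ((c : ℝ) + 1) ^ 2 * (f.totalDegree : ℝ) ^ 3 := key
      _ ≤ ((c : ℝ) + 1) ^ 2 * ((f.totalDegree : ℝ) ^ 3 + f.totalDegree * L.card + M.card) := by
          refine mul_le_mul_of_nonneg_left ?_ (by positivity)
          nlinarith [mul_nonneg hd0 hL0]
  · /- RULED. -/
    haveI : Infinite K := IsAlgClosed.instInfinite
    by_cases hcone : ∃ p : Fin 3 → K, (translate p f).IsHomogeneous f.totalDegree
    · -- a cone: all lines pass through the vertex [Kollar2015, §7 ¶54]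
      obtain ⟨p, hp⟩ := hcone
      have h1 : I.card ≤ 1 := card_le_one_of_cone hf p hp (by omega) L M hL hM hLM hLf hMf I hI
      have h1' : (I.card : ℝ) ≤ 1 := by exact_mod_cast h1
      nlinarith [mul_nonneg (by linarith : (0 : ℝ) ≤ ((c : ℝ) + 1) ^ 2 - 1)
        (by linarith : (0 : ℝ) ≤ (f.totalDegree : ℝ) ^ 3 + f.totalDegree * L.card + M.card - 27)]
    by_cases hcyl : ∃ v : Fin 3 → K, v ≠ 0 ∧ ∀ (p : Fin 3 → K) (t : K),
        eval (p + t • v) f = eval p f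
    · -- a cylinder (cone with vertex at infinity): no such point at all
      obtain ⟨v, hv, hcv⟩ := hcyl
      have h0 : I.card = 0 :=
        card_eq_zero_of_cylinder hf (by omega) hv hcv L M hL hM hLM hLf hMf I hI
      rw [h0, Nat.cast_zero]
      positivity
    /- any other ruled surface: Proposition 55 (4), (5) [Kollar2015, §2 (20)]:
      `|I| ≤ d |L| + 2 |M|`. -/
    obtain ⟨E, hE2, hE⟩ := H55 K f hf hd hruled hcone hcyl
    -- choose, for every point of `I`, a line of `M` through it
    have hMch : ∀ z ∈ I, ∃ m ∈ M, z ∈ m := fun z hz => (hI z hz).2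
    choose! mOf hmOfM hzmOf using hMch
    -- on a fixed line `ℓ ∈ L`, distinct points of `I` have distinct chosen `M`-lines
    have hinj : ∀ ℓ ∈ L, Set.InjOn mOf ↑(I.filter fun z => z ∈ ℓ) := by
      intro ℓ hℓ z hz z' hz' heq
      rw [Finset.coe_filter] at hz hz'
      obtain ⟨hzI, hzℓ⟩ := hz
      obtain ⟨hz'I, hz'ℓ⟩ := hz'
      have hne : ℓ ≠ mOf z := fun h => Finset.disjoint_left.1 hLM hℓ (h ▸ hmOfM z hzI)
      have hz'm : z' ∈ mOf z := by rw [heq]; exact hzmOf z' hz'I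
      exact eq_of_mem_of_mem (hL ℓ hℓ) (hM _ (hmOfM z hzI)) hne hzℓ (hzmOf z hzI) hz'ℓ hz'm
    -- points of `I ∩ ℓ` whose chosen `M`-line lies in a set `T` number at most `|T|`
    have hcount : ∀ ℓ ∈ L, ∀ T : Finset (AffineSubspace K (Fin 3 → K)),
        ((I.filter fun z => z ∈ ℓ).filter fun z => mOf z ∈ T).card ≤ T.card := by
      intro ℓ hℓ T
      have hinj' : Set.InjOn mOf ↑((I.filter fun z => z ∈ ℓ).filter fun z => mOf z ∈ T) :=
        (hinj ℓ hℓ).mono (by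
          intro z hz
          exact Finset.mem_coe.2 (Finset.mem_filter.1 (Finset.mem_coe.1 hz)).1)
      calc ((I.filter fun z => z ∈ ℓ).filter fun z => mOf z ∈ T).card
          = (((I.filter fun z => z ∈ ℓ).filter fun z => mOf z ∈ T).image mOf).card :=
            (Finset.card_image_of_injOn hinj').symm
        _ ≤ T.card := Finset.card_le_card (by
            intro m hm
            rw [Finset.mem_image] at hm
            obtain ⟨z, hz, rfl⟩ := hm
            exact (Finset.mem_filter.1 hz).2)
    -- per-line bounds
    have hline : ∀ ℓ ∈ L,
        (I.filter fun z => z ∈ ℓ).card ≤ if ℓ ∈ E then M.card else f.totalDegree := by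
      intro ℓ hℓ
      split_ifs with hℓE
      · -- a special line of `L`: inject its points into `M`
        calc (I.filter fun z => z ∈ ℓ).card
            = ((I.filter fun z => z ∈ ℓ).filter fun z => mOf z ∈ M).card := by
              congr 1
              refine (Finset.filter_true_of_mem ?_).symm
              intro z hz
              exact hmOfM z (Finset.mem_filter.1 hz).1
          _ ≤ M.card := hcount ℓ hℓ M
      · -- a non-special line of `L`: `≤ d - 2` points on non-special `M`-lines (H55),
        -- `≤ 2` points on the special ones
        have hA : ((I.filter fun z => z ∈ ℓ).filter fun z => mOf z ∉ E).card + 2 ≤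
            f.totalDegree := by
          refine hE ℓ (hL ℓ hℓ) (hLf ℓ hℓ) hℓE _ ?_
          intro z hz
          rw [Finset.mem_filter, Finset.mem_filter] at hz
          obtain ⟨⟨hzI, hzℓ⟩, hmE⟩ := hz
          refine ⟨hzℓ, mOf z, hM _ (hmOfM z hzI), hMf _ (hmOfM z hzI), ?_, hmE, hzmOf z hzI⟩
          exact fun h => Finset.disjoint_left.1 hLM hℓ (h ▸ hmOfM z hzI)
        have hB : ((I.filter fun z => z ∈ ℓ).filter fun z => mOf z ∈ E).card ≤ 2 :=
          (hcount ℓ hℓ E).trans hE2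
        have hsplit : (I.filter fun z => z ∈ ℓ).card ≤
            ((I.filter fun z => z ∈ ℓ).filter fun z => mOf z ∉ E).card +
              ((I.filter fun z => z ∈ ℓ).filter fun z => mOf z ∈ E).card :=
          calc (I.filter fun z => z ∈ ℓ).card
              ≤ (((I.filter fun z => z ∈ ℓ).filter fun z => mOf z ∉ E) ∪
                  ((I.filter fun z => z ∈ ℓ).filter fun z => mOf z ∈ E)).card :=
                Finset.card_le_card (by
                  intro z hz
                  by_cases h : mOf z ∈ E
                  · exact Finset.mem_union_right _ (Finset.mem_filter.2 ⟨hz, h⟩)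
                  · exact Finset.mem_union_left _ (Finset.mem_filter.2 ⟨hz, h⟩))
            _ ≤ _ := Finset.card_union_le _ _
        omega
    -- add up over the lines of `L`
    have hcover : I ⊆ L.biUnion fun ℓ => I.filter fun z => z ∈ ℓ := by
      intro z hz
      obtain ⟨⟨ℓ, hℓ, hzℓ⟩, -⟩ := hI z hz
      exact Finset.mem_biUnion.2 ⟨ℓ, hℓ, Finset.mem_filter.2 ⟨hz, hzℓ⟩⟩
    have hLE : (L.filter fun ℓ => ℓ ∈ E).card ≤ 2 :=
      (Finset.card_le_card fun ℓ hℓ => (Finset.mem_filter.1 hℓ).2).trans hE2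
    have hnat : I.card ≤ f.totalDegree * L.card + 2 * M.card :=
      calc I.card ≤ (L.biUnion fun ℓ => I.filter fun z => z ∈ ℓ).card :=
            Finset.card_le_card hcover
        _ ≤ ∑ ℓ ∈ L, (I.filter fun z => z ∈ ℓ).card := Finset.card_biUnion_le
        _ ≤ ∑ ℓ ∈ L, (if ℓ ∈ E then M.card else f.totalDegree) := Finset.sum_le_sum hline
        _ = ∑ ℓ ∈ L.filter (fun ℓ => ℓ ∈ E), M.card +
              ∑ ℓ ∈ L.filter (fun ℓ => ¬ ℓ ∈ E), f.totalDegree := Finset.sum_ite _ _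
        _ = (L.filter fun ℓ => ℓ ∈ E).card * M.card +
              (L.filter fun ℓ => ¬ ℓ ∈ E).card * f.totalDegree := by
            rw [Finset.sum_const, Finset.sum_const, smul_eq_mul, smul_eq_mul]
        _ ≤ 2 * M.card + L.card * f.totalDegree := by
            gcongr
            exact Finset.filter_subset _ _
        _ = f.totalDegree * L.card + 2 * M.card := by ring
    have hreal : (I.card : ℝ) ≤ f.totalDegree * L.card + 2 * M.card := by exact_mod_cast hnat
    nlinarith [mul_nonneg (by linarith : (0 : ℝ) ≤ ((c : ℝ) + 1) ^ 2 - 2) hM0,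
      mul_nonneg (by linarith : (0 : ℝ) ≤ ((c : ℝ) + 1) ^ 2 - 1) (mul_nonneg hd0 hL0),
      mul_nonneg (by linarith : (0 : ℝ) ≤ ((c : ℝ) + 1) ^ 2)
        (by positivity : (0 : ℝ) ≤ (f.totalDegree : ℝ) ^ 3)]

/-- **Stevens–de Zeeuw, Theorem 4, from the generic-point forms with a free degree constant**
(see `componentBound_closed_of_kollar_generic'`). [cite: StevensDeZeeuw2017, Theorem 4] -/
theorem stevensDeZeeuw_thm4_of_kollar_generic' (c : ℕ) (hc : 1 ≤ c)
    (H13 : ∀ (K : Type) [Field K] [IsAlgClosed K] (f : MvPolynomial (Fin 3) K),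
      Irreducible f → 3 ≤ f.totalDegree → (ringChar K = 0 ∨ f.totalDegree < ringChar K) →
      (¬ ∃ h : MvPolynomial (Fin 3) K, ¬ f ∣ h ∧ ∀ p : Fin 3 → K, eval p f = 0 →
          eval p h ≠ 0 → ∃ ℓ : AffineSubspace K (Fin 3 → K),
            Module.finrank K ℓ.direction = 1 ∧ p ∈ ℓ ∧ ∀ q ∈ ℓ, eval q f = 0) →
      ∃ g : MvPolynomial (Fin 3) K, ¬ f ∣ g ∧ g.totalDegree ≤ c * f.totalDegree ∧
        ∀ ℓ : AffineSubspace K (Fin 3 → K), Module.finrank K ℓ.direction = 1 →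
          (∀ q ∈ ℓ, eval q f = 0) → ∀ q ∈ ℓ, eval q g = 0)
    (H14 : ∀ (K : Type) [Field K] [IsAlgClosed K] (f g : MvPolynomial (Fin 3) K),
      Irreducible f → ¬ f ∣ g →
      ∀ Λ : Finset (AffineSubspace K (Fin 3 → K)),
        (∀ ℓ ∈ Λ, Module.finrank K ℓ.direction = 1) →
        (∀ ℓ ∈ Λ, ∀ q ∈ ℓ, eval q f = 0) → (∀ ℓ ∈ Λ, ∀ q ∈ ℓ, eval q g = 0) →
        ∀ P : Finset (Fin 3 → K), (∀ p ∈ P, ∃ ℓ ∈ Λ, p ∈ ℓ) →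
          (∑ p ∈ P, (((Λ.filter fun ℓ => p ∈ ℓ).card : ℝ) - 1)) ≤
            (1 / 2 : ℝ) * f.totalDegree * g.totalDegree *
              ((f.totalDegree : ℝ) + g.totalDegree - 2))
    (H55 : ∀ (K : Type) [Field K] [IsAlgClosed K] (f : MvPolynomial (Fin 3) K),
      Irreducible f → 3 ≤ f.totalDegree →
      (∃ h : MvPolynomial (Fin 3) K, ¬ f ∣ h ∧ ∀ p : Fin 3 → K, eval p f = 0 →
          eval p h ≠ 0 → ∃ ℓ : AffineSubspace K (Fin 3 → K),
            Module.finrank K ℓ.direction = 1 ∧ p ∈ ℓ ∧ ∀ q ∈ ℓ, eval q f = 0) →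
      (¬ ∃ p : Fin 3 → K, (translate p f).IsHomogeneous f.totalDegree) →
      (¬ ∃ v : Fin 3 → K, v ≠ 0 ∧ ∀ (p : Fin 3 → K) (t : K), eval (p + t • v) f = eval p f) →
      ∃ E : Finset (AffineSubspace K (Fin 3 → K)), E.card ≤ 2 ∧
        ∀ ℓ : AffineSubspace K (Fin 3 → K), Module.finrank K ℓ.direction = 1 →
          (∀ q ∈ ℓ, eval q f = 0) → ℓ ∉ E →
          ∀ P : Finset (Fin 3 → K),
            (∀ p ∈ P, p ∈ ℓ ∧ ∃ ℓ' : AffineSubspace K (Fin 3 → K),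
                Module.finrank K ℓ'.direction = 1 ∧ (∀ q ∈ ℓ', eval q f = 0) ∧
                ℓ' ≠ ℓ ∧ ℓ' ∉ E ∧ p ∈ ℓ') →
            P.card + 2 ≤ f.totalDegree) :
    Literature.Combinatorics.Additive.stevensDeZeeuw_thm4 :=
  Literature.Combinatorics.Additive.stevensDeZeeuw_thm4_of_componentBound_closed
    (componentBound_closed_of_kollar_generic' c hc H13 H14 H55)

end GenericComponentBound

end Literature.Combinatorics.Extremal
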